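import Summits.HodgeConjecture.CorCM.MumfordTateRankSix
import Summits.HodgeConjecture.CorCM.MumfordTateRankFiveCenter
import Literature.AlgebraicGeometry.Motives.HodgeLieWeightOneSl2CenterStructure
import HarnessLib

/-!
# The rungs `dim MT(H¹(X)) ≤ 6` of the Mumford–Tate rank ladder for complex abelian varieties NOT of CM type, I:
# the central idempotent `e ∈ End⁰(X)` cutting out the `𝔰𝔩₂`-part

COR-CM (cell `pub-hodgecm2`, seat `b27` gen 37, count-neutral lane MT-RANK-SIX-ISOGENY; theorems only, no definition,
no named fact; UNCONDITIONAL — nothing here uses or asserts HC_CM).  Sequel of `CorCM/MumfordTateRankSix` (gen 36: for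
`X` not of CM type, `dim MT(H¹X) = dim 𝔷 + dim 𝔡 + 1` with `𝔷` the centre and `𝔡 = [Lie Hg, Lie Hg]` the derived algebra of
`Lie Hg(H¹X)`, `dim 𝔡 ∉ {0,1,2,4,5}`; so `dim MT(H¹X) ≤ 6` forces `dim 𝔡 = 3`) and the generalisation to an ARBITRARY centre of
gen 33's `CorCM/MumfordTateRankFiveCenter` (`dim 𝔷 = 1`).

The abstract structure theorem `HodgeStructure.exists_central_projector_of_finrank_derived_eq_three`
(`Motives/HodgeLieWeightOneSl2Center{,Commutator,Splitting,Vanishing,Corner,CornerDimension,Structure}`) is transported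
to `End⁰(X)` through the rational representation (`bettiRep`, injective with image `End_Hdg(H¹X)` by Riemann's theorem,
`exists_unop_bettiRep_eq_of_mem_endAlg`):

* **`exists_central_idempotent_of_finrank_derived_eq_three`** — for `X` with `0 < dim X` whose Hodge Lie algebra has a
  THREE-DIMENSIONAL derived algebra `[Lie Hg(H¹X), Lie Hg(H¹X)]` (semisimple rank one: `Hg = SL₂ · torus`; such `X` is
  never of CM type, `not_isOfCMType_of_finrank_derived_eq_three`; `dim MT(H¹X) = dim 𝔷 + 4`) — in particular
  (`exists_central_idempotent_of_mtRank_le_six`) for `X` NOT of CM type with `dim MT(H¹X) ≤ 6` — there is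
  an idempotent `e ≠ 0` in the CENTRE of `End⁰(X)` such that, with `x = rk e^*` and `y = rk (1 − e)^*` on `H¹(X(ℂ); ℚ)`:
  `x + y = 2 dim X`, `0 < x`; `4 · dim_ℚ {w | e w = w} = x²` and every `w` with `e w = w` commuting with that corner is a
  rational multiple of `e` (the `𝔰𝔩₂`-part: `End⁰` of dimension `(dim)²` with centre `ℚ`); **every `ℚ`-linear
  endomorphism of `H¹(X(ℂ); ℚ)` killed by `e^*` on both sides and commuting with `Z(End⁰ X)^*` is `w^*` for some
  `w ∈ End⁰(X)`** (the complementary part: the Hodge endomorphisms there are the full commutant of the centre — the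
  lever by which the sequel proves that part to be of CM type); `e = 1 ↔ dim MT(H¹X) = 4`; and the BLOCK form of the
  Hodge Lie algebra: `X' − e^* X' ∈ Lie Hg` for `X' ∈ Lie Hg`, `𝔷 e^* = 0` (the Hodge Lie algebra acts on `e^* H¹`
  through `𝔡` and on `(1 − e^*) H¹` through its centre `𝔷`).

The sequel `CorCM/MumfordTateRankSixIsogeny` reads this as `X ∼ B^{m+1} × X''` with `B` a non-CM elliptic curve or a
quaternion surface and `X''` of CM type.

## References

* [MoonenZarhin1999LowDim] B. Moonen, Yu. Zarhin, *Hodge classes on abelian varieties of low dimension*, Math. Ann.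
  315 (1999), §2 (`MT = 𝔾ₘ·Hg`, `End⁰(X) = End_{Hg}(H¹)`, (2.3)–(2.5)).
* [DeligneMilne1982Tannakian] P. Deligne, J. S. Milne, *Tannakian Categories*, LNM 900 (1982), II Thm. 6.20 (Riemann).
* [Deligne1982HodgeCycles] P. Deligne, *Hodge cycles on abelian varieties*, LNM 900 (1982), I §3 and §5 Prop. 5.1.
* [MumfordAV1970] D. Mumford, *Abelian Varieties* (1970), §19 (the rational representation; Thm. 3 and Cor.).
-/

noncomputable section

open scoped TensorProduct
open CategoryTheory CategoryTheory.Limits Module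

namespace Summit.HodgeConjecture.CorCM

open Literature.AlgebraicGeometry.Motives
open Literature.AlgebraicGeometry.Motives.AbelianVariety
open Literature.AlgebraicGeometry.Motives.HodgeStructure
open Literature.AlgebraicGeometry.HodgeTheory
open Literature.AlgebraicGeometry.ComplexMultiplication (bettiRep bettiRep_injective bettiRep_of
  nontrivial_endAlgebra_of_dim_pos)
open Literature.AlgebraicGeometry.Milne1999 (IsOfCMType isOfCMType_iff_of_isIsogenous)

variable [HodgeTensorFacts.{0, 0}] {X : AbelianVariety ℂ} {n : ℕ}

/-- **`dim MT(H¹X) ≤ 6` for `X` not of CM type forces `dim [Lie Hg, Lie Hg] = 3`** (`t = dim 𝔷 + dim 𝔡 + 1`, `3 ≤ dim 𝔡`,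
`dim 𝔡 ∉ {4, 5}`; `CorCM/MumfordTateRankSix`). [cite: MoonenZarhin1999LowDim, §2] -/
theorem finrank_derived_eq_three_of_mtRank_le_six (hX : IsSmoothProjective n X.X) (h0 : 0 < X.dim) (hcm : ¬ IsOfCMType X)
    (h6 : haveI := BettiUniverse.finite hX 1
      (BettiUniverse.hodge exists_isReal_hodgeModel_holds hX 1).mtRank ≤ 6) :
    haveI := BettiUniverse.finite hX 1
    Module.finrank ℚ ↥(Submodule.span ℚ {B | ∃ X' ∈ (BettiUniverse.hodge exists_isReal_hodgeModel_holds hX 1).hodgeLie,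
        ∃ Y ∈ (BettiUniverse.hodge exists_isReal_hodgeModel_holds hX 1).hodgeLie, X' * Y - Y * X' = B}) = 3 ∧
      (BettiUniverse.hodge exists_isReal_hodgeModel_holds hX 1).mtRank =
        Module.finrank ℚ ↥((BettiUniverse.hodge exists_isReal_hodgeModel_holds hX 1).hodgeLie ⊓
          Subalgebra.toSubmodule (BettiUniverse.hodge exists_isReal_hodgeModel_holds hX 1).endAlg) + 4 := by
  obtain ⟨h1, h3, h4, h5, -⟩ := mtRank_hodge_one_shape hX h0 hcm
  omega

/-- **An abelian variety whose Hodge Lie algebra has a three-dimensional derived algebra is NOT of CM type** (CM ⟺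
`[Lie Hg, Lie Hg] = 0`, `hodgeLie_derived_eq_bot_iff_le_endAlg`). [cite: MoonenZarhin1999LowDim, §2]
[cite: Deligne1982HodgeCycles, I §5 Prop. 5.1] -/
theorem not_isOfCMType_of_finrank_derived_eq_three (hX : IsSmoothProjective n X.X)
    (h3 : haveI := BettiUniverse.finite hX 1
      Module.finrank ℚ ↥(Submodule.span ℚ {B | ∃ X' ∈ (BettiUniverse.hodge exists_isReal_hodgeModel_holds hX 1).hodgeLie,
        ∃ Y ∈ (BettiUniverse.hodge exists_isReal_hodgeModel_holds hX 1).hodgeLie, X' * Y - Y * X' = B}) = 3) :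
    ¬ IsOfCMType X := by
  have hn : X.dim = n := schemeDim_eq_holds hX
  subst hn
  haveI := BettiUniverse.finite hX 1
  set H := BettiUniverse.hodge exists_isReal_hodgeModel_holds hX 1 with hH
  obtain ⟨ψ⟩ := BettiUniverse.hodge_isPolarizable exists_isReal_hodgeModel_holds hX 1
  intro hcm
  have hle : H.hodgeLie ≤ Subalgebra.toSubmodule H.endAlg :=
    (hodgeLie_le_endAlg_iff H).2 ((isOfCMType_iff_mumfordTateLieAlgebra_le_endAlg hX).1 hcm)
  have hbot := (hodgeLie_derived_eq_bot_iff_le_endAlg H (by simp) (BettiUniverse.hodge_isEffective _ hX 1) ψ).2 hle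
  rw [hbot, finrank_bot] at h3
  exact absurd h3 (by norm_num)

/-- **The central idempotent of `End⁰(X)` cutting out the `𝔰𝔩₂`-part**, for a complex abelian variety `X` with
`0 < dim X` whose Hodge Lie algebra has a THREE-dimensional derived algebra (any centre; see the module docstring for the
list of properties; `dim MT(H¹X) = 4 ↔ e = 1`).  Transport of
`HodgeStructure.exists_central_projector_of_finrank_derived_eq_three` along `w ↦ w^*` (`bettiRep`, injective onto
`End_Hdg(H¹X)`, an anti-homomorphism — harmless since `e` is central).  [cite: MoonenZarhin1999LowDim, §2]
[cite: DeligneMilne1982Tannakian, II §6 Thm. 6.20] [cite: MumfordAV1970, §19 Thm. 3] -/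
theorem exists_central_idempotent_of_finrank_derived_eq_three (hX : IsSmoothProjective n X.X) (h0 : 0 < X.dim)
    (h3 : haveI := BettiUniverse.finite hX 1
      Module.finrank ℚ ↥(Submodule.span ℚ {B | ∃ X' ∈ (BettiUniverse.hodge exists_isReal_hodgeModel_holds hX 1).hodgeLie,
        ∃ Y ∈ (BettiUniverse.hodge exists_isReal_hodgeModel_holds hX 1).hodgeLie, X' * Y - Y * X' = B}) = 3) :
    haveI := BettiUniverse.finite hX 1
    ∃ e : X.endAlgebra, e ∈ Subalgebra.center ℚ X.endAlgebra ∧ e * e = e ∧ e ≠ 0 ∧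
      (e = 1 ↔ (BettiUniverse.hodge exists_isReal_hodgeModel_holds hX 1).mtRank = 4) ∧
      ∃ x y : ℕ, x + y = 2 * X.dim ∧ 0 < x ∧
        Module.finrank ℚ (LinearMap.range (MulOpposite.unop (bettiRep X e))) = x ∧
        Module.finrank ℚ (LinearMap.ker (MulOpposite.unop (bettiRep X e))) = y ∧
        (∀ K : Submodule ℚ X.endAlgebra, (∀ w, w ∈ K ↔ e * w = w) → 4 * Module.finrank ℚ K = x ^ 2) ∧
        (∀ w : X.endAlgebra, e * w = w → (∀ w' : X.endAlgebra, e * w' = w' → w * w' = w' * w) → ∃ c : ℚ, w = c • e) ∧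
        (∀ a : Module.End ℚ (bettiCohomology X.X 1),
          a * MulOpposite.unop (bettiRep X e) = 0 → MulOpposite.unop (bettiRep X e) * a = 0 →
          (∀ z ∈ Subalgebra.center ℚ X.endAlgebra,
            a * MulOpposite.unop (bettiRep X z) = MulOpposite.unop (bettiRep X z) * a) →
          ∃ w : X.endAlgebra, MulOpposite.unop (bettiRep X w) = a) ∧
        (∀ X' ∈ (BettiUniverse.hodge exists_isReal_hodgeModel_holds hX 1).hodgeLie,
          X' - MulOpposite.unop (bettiRep X e) * X' ∈ (BettiUniverse.hodge exists_isReal_hodgeModel_holds hX 1).hodgeLie) ∧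
        (∀ Z' ∈ (BettiUniverse.hodge exists_isReal_hodgeModel_holds hX 1).hodgeLie ⊓
            Subalgebra.toSubmodule (BettiUniverse.hodge exists_isReal_hodgeModel_holds hX 1).endAlg,
          Z' * MulOpposite.unop (bettiRep X e) = 0) := by
  have hcm : ¬ IsOfCMType X := not_isOfCMType_of_finrank_derived_eq_three hX h3
  have hn : X.dim = n := schemeDim_eq_holds hX
  subst hn
  haveI := BettiUniverse.finite hX 1
  haveI : Module.Finite ℚ X.endAlgebra := finiteDimensional_endAlgebra_holds X
  have ht : (BettiUniverse.hodge exists_isReal_hodgeModel_holds hX 1).mtRank =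
      Module.finrank ℚ ↥((BettiUniverse.hodge exists_isReal_hodgeModel_holds hX 1).hodgeLie ⊓
        Subalgebra.toSubmodule (BettiUniverse.hodge exists_isReal_hodgeModel_holds hX 1).endAlg) + 4 := by
    obtain ⟨h1, -, -, -, -⟩ := mtRank_hodge_one_shape hX h0 hcm
    omega
  set V := bettiCohomology X.X 1
  set H := BettiUniverse.hodge exists_isReal_hodgeModel_holds hX 1 with hH
  obtain ⟨ψ⟩ := BettiUniverse.hodge_isPolarizable exists_isReal_hodgeModel_holds hX 1
  have hne : ¬ H.hodgeLie ≤ Subalgebra.toSubmodule H.endAlg := fun h =>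
    hcm ((isOfCMType_iff_mumfordTateLieAlgebra_le_endAlg hX).2 ((hodgeLie_le_endAlg_iff H).1 h))
  obtain ⟨p, hpA, hpp, hp0, hpc, -, hDp, hZp, hp1, hdim, hcen, hlever⟩ :=
    exists_central_projector_of_finrank_derived_eq_three H ψ (by simp) (BettiUniverse.hodge_isEffective _ hX 1) hne h3
  -- the rational representation `ρ : w ↦ w^*`
  let ρ : X.endAlgebra →ₗ[ℚ] Module.End ℚ V :=
    (MulOpposite.opLinearEquiv ℚ (M := Module.End ℚ V)).symm.toLinearMap ∘ₗ (bettiRep X).toLinearMap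
  have hρ : ∀ w, ρ w = MulOpposite.unop (bettiRep X w) := fun w => rfl
  have hρinj : Function.Injective ρ := fun w w' h => by
    rw [hρ, hρ] at h
    exact bettiRep_injective (MulOpposite.unop_injective h)
  have hρA : ∀ w, ρ w ∈ H.endAlg := fun w =>
    Literature.AlgebraicGeometry.ComplexMultiplication.unop_bettiRep_mem_endAlg exists_isReal_hodgeModel_holds
      hodgePQ_independent_of_hodgeModel_holds w
  have hρmul : ∀ w w', ρ (w * w') = ρ w' * ρ w := fun w w' => by rw [hρ, hρ, hρ, map_mul, MulOpposite.unop_mul]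
  have hρone : ρ 1 = 1 := by rw [hρ, map_one, MulOpposite.unop_one]
  -- the central idempotent
  obtain ⟨e, he⟩ := exists_unop_bettiRep_eq_of_mem_endAlg hX hpA
  have hρe : ρ e = p := he
  have hwe : ∀ w, ρ w * p = ρ (e * w) := fun w => by rw [hρmul, hρe]
  have hec : e ∈ Subalgebra.center ℚ X.endAlgebra := by
    rw [Subalgebra.mem_center_iff]
    intro w
    apply hρinj
    rw [hρmul, hρmul, hρe]
    exact (hpc _ (hρA w)).symm
  have hee : e * e = e := hρinj (by rw [hρmul, hρe, hpp])
  have he0 : e ≠ 0 := fun h => hp0 (by rw [← hρe, h, map_zero])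
  -- `e = 1 ↔ t = 4`
  have he1 : e = 1 ↔ H.mtRank = 4 := by
    rw [ht]
    constructor
    · intro h1
      have hp1' : p = 1 := by rw [← hρe, h1, hρone]
      rw [hp1.1 hp1', finrank_bot]
    · intro h4
      have hz : Module.finrank ℚ ↥(H.hodgeLie ⊓ Subalgebra.toSubmodule H.endAlg) = 0 := by omega
      have hbot : H.hodgeLie ⊓ Subalgebra.toSubmodule H.endAlg = ⊥ := Submodule.finrank_eq_zero.1 hz
      exact hρinj (by rw [hρe, hρone, hp1.2 hbot])
  -- the corner, transported
  have hfin : ∀ K : Submodule ℚ X.endAlgebra, (∀ w, w ∈ K ↔ e * w = w) →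
      Module.finrank ℚ K =
        Module.finrank ℚ ↥(Subalgebra.toSubmodule H.endAlg ⊓ LinearMap.ker (LinearMap.mulRight ℚ p - LinearMap.id)) := by
    intro K hK
    have hmap : K.map ρ = Subalgebra.toSubmodule H.endAlg ⊓ LinearMap.ker (LinearMap.mulRight ℚ p - LinearMap.id) := by
      ext a
      simp only [Submodule.mem_map, Submodule.mem_inf, Subalgebra.mem_toSubmodule, LinearMap.mem_ker,
        LinearMap.sub_apply, LinearMap.mulRight_apply, LinearMap.id_coe, id_eq, sub_eq_zero]
      constructor
      · rintro ⟨w, hw, rfl⟩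
        refine ⟨hρA w, ?_⟩
        rw [hwe, (hK w).1 hw]
      · rintro ⟨ha, hap⟩
        obtain ⟨w, hw⟩ := exists_unop_bettiRep_eq_of_mem_endAlg hX ha
        have hρw : ρ w = a := hw
        refine ⟨w, (hK w).2 (hρinj ?_), hρw⟩
        rw [← hwe, hρw, hap]
    rw [← hmap, ← (Submodule.equivMapOfInjective ρ hρinj _).finrank_eq]
  -- the centre of the corner, transported
  have hcen' : ∀ w : X.endAlgebra, e * w = w → (∀ w' : X.endAlgebra, e * w' = w' → w * w' = w' * w) →
      ∃ c : ℚ, w = c • e := by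
    intro w hw hwc
    have hwp : ρ w * p = ρ w := by rw [hwe, hw]
    obtain ⟨c, hc⟩ := hcen (ρ w) (hρA w) hwp (fun a ha hap => by
      obtain ⟨w', hw'⟩ := exists_unop_bettiRep_eq_of_mem_endAlg hX ha
      have hρw' : ρ w' = a := hw'
      have hew' : e * w' = w' := hρinj (by rw [← hwe, hρw', hap])
      rw [← hρw', ← hρmul, ← hρmul, hwc w' hew'])
    exact ⟨c, hρinj (by rw [hc, map_smul, hρe])⟩
  -- the lever
  have hlever' : ∀ a : Module.End ℚ V, a * p = 0 → p * a = 0 →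
      (∀ z ∈ Subalgebra.center ℚ X.endAlgebra, a * ρ z = ρ z * a) → ∃ w : X.endAlgebra, ρ w = a := by
    intro a hap hpa haz
    have haZ : ∀ Z ∈ H.hodgeLie ⊓ Subalgebra.toSubmodule H.endAlg, a * Z = Z * a := by
      intro Z hZ
      obtain ⟨hZh, hZA⟩ := Submodule.mem_inf.1 hZ
      rw [Subalgebra.mem_toSubmodule] at hZA
      obtain ⟨z, hz⟩ := exists_unop_bettiRep_eq_of_mem_endAlg hX hZA
      have hρz : ρ z = Z := hz
      have hzc : z ∈ Subalgebra.center ℚ X.endAlgebra := by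
        rw [Subalgebra.mem_center_iff]
        intro w
        apply hρinj
        rw [hρmul, hρmul, hρz]
        exact commute_of_mem_hodgeLie H hZh ⟨ρ w, hρA w⟩
      rw [← hρz]
      exact haz z hzc
    obtain ⟨w, hw⟩ := exists_unop_bettiRep_eq_of_mem_endAlg hX (hlever a hap hpa haZ)
    exact ⟨w, hw⟩
  -- dimensions
  have hsum := LinearMap.finrank_range_add_finrank_ker p
  rw [finrank_bettiCohomology_one] at hsum
  refine ⟨e, hec, hee, he0, he1, Module.finrank ℚ (LinearMap.range p), Module.finrank ℚ (LinearMap.ker p), hsum, ?_,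
    by rw [← he], by rw [← he], fun K hK => ?_, hcen', ?_, ?_, fun Z' hZ' => by rw [← hρ, hρe]; exact hZp Z' hZ'⟩
  · refine Nat.pos_of_ne_zero fun h => hp0 ?_
    exact LinearMap.range_eq_bot.1 (Submodule.finrank_eq_zero.1 h)
  · rw [hfin K hK, hdim]
  · intro a hap hpa haz
    rw [← hρ, hρe] at hap hpa
    exact hlever' a hap hpa (fun z hz => haz z hz)
  · -- block-diagonality: `(1 − p) 𝔥 ⊆ 𝔥` (`𝔥 = 𝔷 ⊕ 𝔡`, `p 𝔷 = 0`, `p D = D`)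
    intro X' hX'
    rw [← hρ, hρe]
    rw [← hodgeLie_center_sup_derived_eq H (by simp) (BettiUniverse.hodge_isEffective _ hX 1) ψ] at hX'
    obtain ⟨z, hz, D, hD, rfl⟩ := Submodule.mem_sup.1 hX'
    have hz𝔥 : z ∈ H.hodgeLie := (Submodule.mem_inf.1 hz).1
    have hpz : p * z = 0 := by rw [← commute_of_mem_hodgeLie H hz𝔥 ⟨p, hpA⟩]; exact hZp z hz
    have hpD : p * D = D := (hDp D hD).2
    have : z + D - p * (z + D) = z := by rw [mul_add, hpz, hpD, zero_add, add_sub_cancel_right]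
    rw [this]
    exact hz𝔥

/-- **The central idempotent of `End⁰(X)` cutting out the `𝔰𝔩₂`-part, for `X` NOT of CM type with `dim MT(H¹X) ≤ 6`**
(then `dim [Lie Hg, Lie Hg] = 3`, `finrank_derived_eq_three_of_mtRank_le_six`).  [cite: MoonenZarhin1999LowDim, §2]
[cite: DeligneMilne1982Tannakian, II §6 Thm. 6.20] [cite: MumfordAV1970, §19 Thm. 3] -/
theorem exists_central_idempotent_of_mtRank_le_six (hX : IsSmoothProjective n X.X) (h0 : 0 < X.dim)
    (hcm : ¬ IsOfCMType X)
    (h6 : haveI := BettiUniverse.finite hX 1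
      (BettiUniverse.hodge exists_isReal_hodgeModel_holds hX 1).mtRank ≤ 6) :
    haveI := BettiUniverse.finite hX 1
    ∃ e : X.endAlgebra, e ∈ Subalgebra.center ℚ X.endAlgebra ∧ e * e = e ∧ e ≠ 0 ∧
      (e = 1 ↔ (BettiUniverse.hodge exists_isReal_hodgeModel_holds hX 1).mtRank = 4) ∧
      ∃ x y : ℕ, x + y = 2 * X.dim ∧ 0 < x ∧
        Module.finrank ℚ (LinearMap.range (MulOpposite.unop (bettiRep X e))) = x ∧
        Module.finrank ℚ (LinearMap.ker (MulOpposite.unop (bettiRep X e))) = y ∧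
        (∀ K : Submodule ℚ X.endAlgebra, (∀ w, w ∈ K ↔ e * w = w) → 4 * Module.finrank ℚ K = x ^ 2) ∧
        (∀ w : X.endAlgebra, e * w = w → (∀ w' : X.endAlgebra, e * w' = w' → w * w' = w' * w) → ∃ c : ℚ, w = c • e) ∧
        (∀ a : Module.End ℚ (bettiCohomology X.X 1),
          a * MulOpposite.unop (bettiRep X e) = 0 → MulOpposite.unop (bettiRep X e) * a = 0 →
          (∀ z ∈ Subalgebra.center ℚ X.endAlgebra,
            a * MulOpposite.unop (bettiRep X z) = MulOpposite.unop (bettiRep X z) * a) →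
          ∃ w : X.endAlgebra, MulOpposite.unop (bettiRep X w) = a) ∧
        (∀ X' ∈ (BettiUniverse.hodge exists_isReal_hodgeModel_holds hX 1).hodgeLie,
          X' - MulOpposite.unop (bettiRep X e) * X' ∈ (BettiUniverse.hodge exists_isReal_hodgeModel_holds hX 1).hodgeLie) ∧
        (∀ Z' ∈ (BettiUniverse.hodge exists_isReal_hodgeModel_holds hX 1).hodgeLie ⊓
            Subalgebra.toSubmodule (BettiUniverse.hodge exists_isReal_hodgeModel_holds hX 1).endAlg,
          Z' * MulOpposite.unop (bettiRep X e) = 0) :=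
  exists_central_idempotent_of_finrank_derived_eq_three hX h0 (finrank_derived_eq_three_of_mtRank_le_six hX h0 hcm h6).1

end Summit.HodgeConjecture.CorCM

end
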